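import Literature.NumberTheory.Sieve.SieveFunctionsProofs
import HarnessLib

/-!
# The `β`-sieve in dimensions `1/2 ≤ κ ≤ 1`: the least-`β` and the greatest-`β` pins coincide

Trunk `AntSieve` (topic `NumberTheory/Sieve`); companion to `SieveFunctions.lean`,
`SieveFunctionsBridge.lean` and `SieveFunctionsProofs.lean` (item
`provefact Literature.SieveSequence.jurkat_richert_upper`, verdict MISSTATED: the least-`β` pin
`IsBetaSieveData` behind `upperSieveFun`, `lowerSieveFun`, `siftingLimit` is not Iwaniec's
definition of `β_κ`, which is the GREATEST admissible parameter, `IsGreatestBetaSieveData`).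

This file settles the range of dimensions in which the two pins nevertheless agree. Everything is
proved (standard axioms only).

## Results

* `SieveAdjoint.strictMonoOn_qFun`: for `1/2 < κ < 1` Iwaniec's adjoint `q_κ` is strictly
  increasing on `(0, ∞)` (`q_κ' = (2κ − 1) r_{κ−1,κ} > 0`, Greaves (4.2.3.18) with the Laplace
  representation (4.2.3.6)); hence it has at most one positive zero (Greaves, Lemma 4.2.3 (i):
  "fewer than `a + b = 2κ` zeros").
* `SieveAdjoint.boundaryConst_one_ne_zero`: for `1/2 < κ < 1` the `Q`-boundary constant at `β = 1`,
  `q_κ(1) − κ ∫_0^1 q_κ(x+1) x^{−κ} dx`, is NOT zero. By the adjoint equation it differs from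
  `ε^{1−κ} q_κ(ε)` by `κ ∫_0^ε q_κ(x+1) x^{−κ} dx = O(ε^{1−κ})` (`SieveAdjoint.rpow_mul_qFun_eq`),
  while the lower bound `r_{κ−1,κ}(t) ≥ Γ(2−κ)/Γ(2−2κ) · t^{κ−2}` (the exact order, Greaves
  Lemma 4.2.4 (i)) gives `ε^{1−κ} q_κ(ε) ≤ M ε^{1−κ} − c` with
  `c = (2κ−1)Γ(2−κ)/((1−κ)Γ(2−2κ)) > 0` (`SieveAdjoint.rpow_mul_qFun_le`).
* `IsBetaSieveSolution.boundaryConst_eq_zero_of_beta_eq_one`: a NORMALISED solution of the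
  `β`-sieve system with `β = 1` (and `κ < 1`) forces that constant to vanish (Greaves (4.2.4.2) and
  (4.2.4.7) with `B = 0`, `β = 1`: the inner product `⟨Q, q_κ⟩` is constant on `[1, ∞)` and tends
  to `0`). The proof identifies `F − f` with the forward combination `s^{−κ} fwdQ κ 1 A` of
  `SieveFunctionsConstruction` (method of steps, `eq_zero_of_delay`) and uses the inner-product
  engine of `SieveFunctionsProofs`.
* `IsBetaSieveSolution.one_lt_of_half_lt`: consequently EVERY normalised solution of dimension
  `κ > 1/2` has `β > 1` (for `κ ≥ 1` this is `IsBetaSieveSolution.one_lt` of `SieveAdjoint`), in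
  accordance with Greaves (4.2.4.10) ("`β > 1` when `κ > 1/2`"), and `q_κ(β − 1) = 0` without the
  alternative `β = 1` left open in `IsBetaSieveSolution.beta_eq_one_or_qFun_eq_zero`.
* `IsBetaSieveSolution.beta_eq_of_lt_one`: for `1/2 < κ < 1` all normalised solutions have the
  same `β` (`= 1 +` the unique zero of `q_κ`), so `IsBetaSieveData κ = IsGreatestBetaSieveData κ`
  and — DEFINITIONALLY, both data being `Classical.epsilon` of the same predicate —
  `betaSieveData κ = greatestBetaSieveData κ`, `upperSieveFun κ = iwaniecUpperSieveFun κ`,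
  `lowerSieveFun κ = iwaniecLowerSieveFun κ`, `siftingLimit κ = iwaniecSiftingLimit κ`,
  `betaSieveConst κ = iwaniecSieveConst κ` for ALL `1/2 ≤ κ ≤ 1` (the endpoints are
  `SieveFunctionsBridge.betaSieveData_half/one`).
* `SieveSequence.jurkat_richert_upper_of_le_one`, `SieveSequence.jurkat_richert_lower_of_le_one`:
  the restriction of the (misstated, and for `κ = 2` refuted) named facts
  `SieveSequence.jurkat_richert_upper/lower` to dimensions `1/2 ≤ κ ≤ 1` follows from the corrected
  corollaries `SieveSequence.Iwaniec1980_upper/lower` of Iwaniec's Theorem 1. Together with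
  `SieveFunctionsProofs.siftingLimit_three_halves_lt` (`κ = 3/2`: the pins differ) and
  `JurkatRichertRefutation.lean` (`κ = 2`: both facts are false) this delineates exactly what
  survives of the least-`β` statements.
* Unconditional values: `one_lt_siftingLimit`, `one_lt_iwaniecSiftingLimit` (`β_κ > 1` for
  `κ > 1/2`), `IsBetaSieveSolution.beta_eq_one_iff` (`β = 1 ↔ κ = 1/2` for `κ ≥ 1/2`).

## References

* [Greaves2001] G. Greaves, *Sieves in Number Theory*, Springer (2001), §4.2.3 (Lemma 4.2.3,
  Lemma 4.2.4 (i), (4.2.3.6), (4.2.3.16), (4.2.3.18)), §4.2.4 ((4.2.4.2), (4.2.4.7), (4.2.4.10)).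
* [IwaniecActaArith1980] H. Iwaniec, *Rosser's sieve*, Acta Arith. 36 (1980), 171–202, §§5–7.
-/

open Filter Asymptotics Set MeasureTheory intervalIntegral Topology

noncomputable section

namespace Literature.NumberTheory.Sieve

open SieveAdjoint BetaSieveForward

/-! ### Iwaniec's adjoint `q_κ` for `1/2 ≤ κ < 1` -/

namespace SieveAdjoint

variable {κ : ℝ}

/-- For `1/2 ≤ κ < 1`, `⌊2κ⌋ = 1`. [folklore] -/
theorem floor_two_mul_eq_one (hκ : 1 / 2 ≤ κ) (hκ1 : κ < 1) : ⌊2 * κ⌋₊ = 1 := by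
  rw [Nat.floor_eq_iff (by linarith)]
  constructor
  · norm_num; linarith
  · norm_num; linarith

/-- For `1/2 ≤ κ < 1`, `q_κ` is the first rung above the Laplace solution `r_{κ−1,κ}`:
`qFun κ = rLadder κ (2κ − 1) 1` (Greaves (4.2.3.17)–(4.2.3.18)). [cite: Greaves2001, (4.2.3.18)] -/
theorem qFun_eq_rLadder_one (hκ : 1 / 2 ≤ κ) (hκ1 : κ < 1) :
    qFun κ = rLadder κ (2 * κ - 1) 1 := by
  unfold qFun
  rw [floor_two_mul_eq_one hκ hκ1, Nat.cast_one]

/-- **The derivative of `q_κ` for `1/2 ≤ κ < 1`**: `q_κ'(s) = (2κ − 1) r_{κ−1,κ}(s)` on `(0, ∞)`,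
with `r_{κ−1,κ} = rBase κ (2κ − 1)` the (positive) Laplace solution (Greaves (4.2.3.18) with
`c_{a,b} = Γ(a+b−1)/Γ(a+b)`, and (4.2.3.6)). [cite: Greaves2001, (4.2.3.18)] -/
theorem hasDerivAt_qFun_of_lt_one (hκ : 1 / 2 ≤ κ) (hκ1 : κ < 1) {s : ℝ} (hs : 0 < s) :
    HasDerivAt (qFun κ) ((2 * κ - 1) * rBase κ (2 * κ - 1) s) s := by
  have h := hasDerivAt_rLadder_succ κ (x₀ := 2 * κ - 1) (by linarith) 0 hs
  rw [qFun_eq_rLadder_one hκ hκ1]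
  simpa [rLadder_zero] using h

/-- **For `1/2 < κ < 1`, `q_κ` is strictly increasing on `(0, ∞)`**, since
`q_κ' = (2κ − 1) r_{κ−1,κ} > 0`; this is Greaves's proof of Lemma 4.2.3 (i) ("the number of
positive zeros of `r_{a,b}` is less than `a + b`", here `a + b = 2κ < 2`) in the case
`a + b − 1 < 1 < a + b`. [cite: Greaves2001, Lemma 4.2.3 (i)] -/
theorem strictMonoOn_qFun (hκ : 1 / 2 < κ) (hκ1 : κ < 1) : StrictMonoOn (qFun κ) (Ioi 0) := by
  refine strictMonoOn_of_deriv_pos (convex_Ioi 0) (continuousOn_qFun κ) fun s hs => ?_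
  rw [interior_Ioi] at hs
  have hs0 : 0 < s := hs
  rw [(hasDerivAt_qFun_of_lt_one hκ.le hκ1 hs0).deriv]
  exact mul_pos (by linarith) (rBase_pos κ (by linarith) hs0)

/-- For `1/2 < κ < 1`, `q_κ` has at most one positive zero (Greaves, Lemma 4.2.3 (i); by
Lemma 4.2.3 (ii) it has exactly one). [cite: Greaves2001, Lemma 4.2.3 (i)] -/
theorem qFun_zero_unique (hκ : 1 / 2 < κ) (hκ1 : κ < 1) {s t : ℝ} (hs : 0 < s) (ht : 0 < t)
    (hs0 : qFun κ s = 0) (ht0 : qFun κ t = 0) : s = t :=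
  (strictMonoOn_qFun hκ hκ1).injOn hs ht (hs0.trans ht0.symm)

/-! ### The behaviour of `q_κ` at `0+` for `1/2 < κ < 1` -/

/-- **Lower bound for `r_{κ−1,κ}`**: `r_{κ−1,κ}(t) ≥ Γ(2 − κ)/Γ(2 − 2κ) · t^{κ−2}` for `t > 0`,
`1/2 ≤ κ < 1` (from `ψ_κ(z) ≥ z^κ` in the Laplace representation (4.2.3.6), `laplaceFun_ge`;
this is the exact order at `0+`: Greaves, Lemma 4.2.4 (i) gives
`r_{κ−1,κ}(t) ∼ e^{κγ} Γ(2−κ)/Γ(2−2κ) · t^{κ−2}`). [cite: Greaves2001, Lemma 4.2.4 (i)] -/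
theorem rBase_ge_rpow (hκ : 1 / 2 ≤ κ) (hκ1 : κ < 1) {t : ℝ} (ht : 0 < t) :
    Real.Gamma (2 - κ) / Real.Gamma (2 - 2 * κ) * t ^ (κ - 2) ≤ rBase κ (2 * κ - 1) t := by
  have h := laplaceFun_ge κ (x := 2 * κ - 1) (by linarith) (by linarith) ht
  have e1 : κ - (2 * κ - 1) + 1 = 2 - κ := by ring
  have e2 : -(2 - κ) = κ - 2 := by ring
  rw [e1, e2] at h
  have hG : 0 < Real.Gamma (2 - 2 * κ) := Real.Gamma_pos_of_pos (by linarith)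
  have e3 : (1 : ℝ) - (2 * κ - 1) = 2 - 2 * κ := by ring
  unfold rBase
  rw [e3, div_mul_eq_mul_div]
  exact div_le_div_of_nonneg_right h hG.le

/-- `q_κ` near `0` for `1/2 ≤ κ < 1`: `q_κ(ε) = q_κ(1) − (2κ − 1) ∫_ε^1 r_{κ−1,κ}` (the ladder
recursion (4.2.3.18) integrated). [cite: Greaves2001, (4.2.3.18)] -/
theorem qFun_eq_sub_integral (hκ : 1 / 2 ≤ κ) (hκ1 : κ < 1) (ε : ℝ) :
    qFun κ ε = qFun κ 1 - (2 * κ - 1) * ∫ t in ε..1, rBase κ (2 * κ - 1) t := by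
  rw [qFun_eq_rLadder_one hκ hκ1]
  show rLadder κ (2 * κ - 1) (0 + 1) ε =
    rLadder κ (2 * κ - 1) (0 + 1) 1 - (2 * κ - 1) * ∫ t in ε..1, rBase κ (2 * κ - 1) t
  rw [rLadder_succ, rLadder_succ_one, intervalIntegral.integral_symm 1 ε]
  simp only [Nat.cast_zero, add_zero, rLadder_zero]
  ring

/-- **`ε^{1−κ} q_κ(ε)` is bounded away from `0`, negatively, as `ε → 0+`** (`1/2 < κ < 1`): there
are `M` and `c > 0` with `ε^{1−κ} q_κ(ε) ≤ M ε^{1−κ} − c` for all `0 < ε ≤ 1`; one may take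
`c = (2κ − 1) Γ(2 − κ) / ((1 − κ) Γ(2 − 2κ))`. (Greaves (4.2.3.16): `r(s) < 0` as `s → 0+` for
`1 < a + b < 2`; here with the exact order `s^{κ−1}` supplied by Lemma 4.2.4 (i).)
[cite: Greaves2001, (4.2.3.16) and Lemma 4.2.4 (i)] -/
theorem rpow_mul_qFun_le (hκ : 1 / 2 < κ) (hκ1 : κ < 1) :
    ∃ M c : ℝ, 0 < c ∧ ∀ ε : ℝ, 0 < ε → ε ≤ 1 →
      ε ^ (1 - κ) * qFun κ ε ≤ M * ε ^ (1 - κ) - c := by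
  set c₁ : ℝ := Real.Gamma (2 - κ) / Real.Gamma (2 - 2 * κ) with hc₁
  have hc₁0 : 0 < c₁ :=
    div_pos (Real.Gamma_pos_of_pos (by linarith)) (Real.Gamma_pos_of_pos (by linarith))
  set c : ℝ := (2 * κ - 1) * c₁ / (1 - κ) with hc
  have h1κ : 0 < 1 - κ := by linarith
  have hc0 : 0 < c := div_pos (mul_pos (by linarith) hc₁0) h1κ
  refine ⟨qFun κ 1 + c, c, hc0, fun ε hε hε1 => ?_⟩
  have h0 : (0 : ℝ) ∉ uIcc ε 1 := by
    rw [uIcc_of_le hε1]; intro h; linarith [h.1]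
  -- `∫_ε^1 t^{κ-2} dt = (1 - ε^{κ-1}) / (κ - 1)`
  have hI1 : ∫ t in ε..1, t ^ (κ - 2) = (1 - ε ^ (κ - 1)) / (κ - 1) := by
    rw [integral_rpow (Or.inr ⟨by linarith, h0⟩)]
    rw [show κ - 2 + 1 = κ - 1 by ring, Real.one_rpow]
  -- `∫_ε^1 rBase ≥ c₁ ∫_ε^1 t^{κ-2}`
  have hcont : ContinuousOn (fun t : ℝ => c₁ * t ^ (κ - 2)) (uIcc ε 1) := by
    refine continuousOn_const.mul (continuousOn_id.rpow_const fun x hx => Or.inl ?_)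
    rw [uIcc_of_le hε1] at hx
    exact (lt_of_lt_of_le hε hx.1).ne'
  have hmono : ∫ t in ε..1, c₁ * t ^ (κ - 2) ≤ ∫ t in ε..1, rBase κ (2 * κ - 1) t :=
    intervalIntegral.integral_mono_on hε1 hcont.intervalIntegrable
      (intervalIntegrable_rLadder κ (by linarith) 0 hε one_pos)
      fun t ht => rBase_ge_rpow hκ.le hκ1 (lt_of_lt_of_le hε ht.1)
  rw [intervalIntegral.integral_const_mul, hI1] at hmono
  -- so `q(ε) ≤ q(1) + c - c ε^{κ-1}`
  have hq : qFun κ ε ≤ qFun κ 1 + c - c * ε ^ (κ - 1) := by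
    rw [qFun_eq_sub_integral hκ.le hκ1 ε]
    have hinv : (κ - 1)⁻¹ = -(1 - κ)⁻¹ := by rw [← inv_neg, neg_sub]
    have h2 : (2 * κ - 1) * (c₁ * ((1 - ε ^ (κ - 1)) / (κ - 1))) = c * ε ^ (κ - 1) - c := by
      rw [hc, div_eq_mul_inv, div_eq_mul_inv, hinv]; ring
    have h3 : (2 * κ - 1) * (c₁ * ((1 - ε ^ (κ - 1)) / (κ - 1))) ≤
        (2 * κ - 1) * ∫ t in ε..1, rBase κ (2 * κ - 1) t :=
      mul_le_mul_of_nonneg_left hmono (by linarith)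
    linarith [h2, h3]
  -- multiply by `ε^{1-κ} > 0`
  have hpow : 0 < ε ^ (1 - κ) := Real.rpow_pos_of_pos hε _
  have hone : ε ^ (1 - κ) * ε ^ (κ - 1) = 1 := by
    rw [← Real.rpow_add hε, show (1 - κ) + (κ - 1) = 0 by ring, Real.rpow_zero]
  calc ε ^ (1 - κ) * qFun κ ε ≤ ε ^ (1 - κ) * (qFun κ 1 + c - c * ε ^ (κ - 1)) :=
        mul_le_mul_of_nonneg_left hq hpow.le
    _ = (qFun κ 1 + c) * ε ^ (1 - κ) - c * (ε ^ (1 - κ) * ε ^ (κ - 1)) := by ring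
    _ = (qFun κ 1 + c) * ε ^ (1 - κ) - c := by rw [hone, mul_one]

/-- **The adjoint equation in pairing form, integrated over `[ε, 1]`**:
`ε^{1−κ} q_κ(ε) = q_κ(1) − κ ∫_ε^1 x^{−κ} q_κ(x + 1) dx` for `0 < ε ≤ 1`
(from `(s^{1−κ} q_κ(s))' = κ s^{−κ} q_κ(s+1)`, Greaves (4.2.2.10)). [cite: Greaves2001, §4.2.2 (2.10)] -/
theorem rpow_mul_qFun_eq (κ : ℝ) {ε : ℝ} (hε : 0 < ε) (hε1 : ε ≤ 1) :
    ε ^ (1 - κ) * qFun κ ε = qFun κ 1 - κ * ∫ x in ε..1, x ^ (-κ) * qFun κ (x + 1) := by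
  have hq := isSieveAdjoint_qFun κ
  have hderiv : ∀ x ∈ uIcc ε 1,
      HasDerivAt (fun t : ℝ => t ^ (1 - κ) * qFun κ t) (κ * x ^ (-κ) * qFun κ (x + 1)) x := by
    intro x hx
    rw [uIcc_of_le hε1] at hx
    exact hq x (lt_of_lt_of_le hε hx.1)
  have hcont : ContinuousOn (fun x : ℝ => κ * x ^ (-κ) * qFun κ (x + 1)) (uIcc ε 1) := by
    rw [uIcc_of_le hε1]
    refine (continuousOn_const.mul (continuousOn_id.rpow_const fun x hx => Or.inl ?_)).mul ?_
    · exact (lt_of_lt_of_le hε hx.1).ne'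
    · exact (continuousOn_comp_add_one (continuousOn_qFun κ)).mono
        fun x hx => show (0 : ℝ) < x from lt_of_lt_of_le hε hx.1
  have h := intervalIntegral.integral_eq_sub_of_hasDerivAt hderiv hcont.intervalIntegrable
  rw [Real.one_rpow, one_mul] at h
  have e : ∫ x in ε..1, κ * x ^ (-κ) * qFun κ (x + 1) =
      κ * ∫ x in ε..1, x ^ (-κ) * qFun κ (x + 1) := by
    rw [← intervalIntegral.integral_const_mul]
    refine intervalIntegral.integral_congr fun x _ => ?_
    ring
  rw [e] at h
  linarith

/-- **For `1/2 < κ < 1` the `Q`-boundary constant at `β = 1` is not zero**: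
`q_κ(1) − κ ∫_0^1 q_κ(x + 1) x^{−κ} dx ≠ 0`. By `rpow_mul_qFun_eq` this constant differs from
`ε^{1−κ} q_κ(ε)` by `κ ∫_0^ε q_κ(x+1) x^{−κ} dx = O(ε^{1−κ})`, so it is the coefficient of the
singular part `s^{κ−1}` of `q_κ` at `0` (Greaves (4.2.4.7), first equation, with `β = 1`:
`lim_{s→1+} C q(s−1)/(s−1)^{κ−1}`), which is negative by `rpow_mul_qFun_le`. In Greaves's terms:
(4.2.4.7) with `B = 0`, `β = 1` would force `C = 0` when `1/2 < κ < 1` (compare (4.2.4.19) for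
`κ ≤ 1/2`), consistent with the choice `β = 1 + α > 1` for `κ > 1/2` in (4.2.4.10); the
nonvanishing itself is not printed there and is proved here from (4.2.3.6) and (4.2.3.18).
[cite: Greaves2001, §4.2.4 (4.7) and (4.10)] -/
theorem boundaryConst_one_ne_zero (hκ : 1 / 2 < κ) (hκ1 : κ < 1) :
    qFun κ 1 - κ * ∫ x in (0 : ℝ)..1, qFun κ (x + 1) * x ^ (-κ) ≠ 0 := by
  intro hC
  obtain ⟨M, c, hc0, hM⟩ := rpow_mul_qFun_le hκ hκ1
  have hκ0 : 0 < κ := by linarith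
  have h1κ : 0 < 1 - κ := by linarith
  -- the integrand `g(x) = x^{-κ} q(x+1)` is integrable on `[0, 1]` and bounded by `B x^{-κ}`
  set g : ℝ → ℝ := fun x => x ^ (-κ) * qFun κ (x + 1) with hg
  have hqc : ContinuousOn (fun x : ℝ => qFun κ (x + 1)) (Icc 0 1) :=
    ((continuousOn_qFun κ).comp (continuousOn_id.add continuousOn_const) fun x hx => by
      show (0 : ℝ) < x + 1; linarith [hx.1])
  obtain ⟨B, hB⟩ := (isCompact_Icc (a := (0 : ℝ)) (b := 1)).exists_bound_of_continuousOn hqc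
  have hB0 : 0 ≤ B := (norm_nonneg _).trans (hB 0 ⟨le_rfl, zero_le_one⟩)
  have hgi : IntervalIntegrable g volume 0 1 := by
    refine (intervalIntegral.intervalIntegrable_rpow' (by linarith : -1 < -κ)).mul_continuousOn ?_
    rwa [uIcc_of_le zero_le_one]
  have hC' : qFun κ 1 = κ * ∫ x in (0 : ℝ)..1, g x := by
    have : ∫ x in (0 : ℝ)..1, g x = ∫ x in (0 : ℝ)..1, qFun κ (x + 1) * x ^ (-κ) :=
      intervalIntegral.integral_congr fun x _ => by simp only [hg]; ring
    rw [this]; linarith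
  -- hence `ε^{1-κ} q(ε) = κ ∫_0^ε g ≥ -κ B ε^{1-κ}/(1-κ)` for `0 < ε ≤ 1`
  have hlow : ∀ ε : ℝ, 0 < ε → ε ≤ 1 → -(κ * B / (1 - κ)) * ε ^ (1 - κ) ≤ ε ^ (1 - κ) * qFun κ ε := by
    intro ε hε hε1
    have hsub0 : uIcc 0 ε ⊆ uIcc 0 1 := by
      rw [uIcc_of_le hε.le, uIcc_of_le zero_le_one]; exact Icc_subset_Icc le_rfl hε1
    have hsub1 : uIcc ε 1 ⊆ uIcc 0 1 := by
      rw [uIcc_of_le hε1, uIcc_of_le zero_le_one]; exact Icc_subset_Icc hε.le le_rfl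
    have hadd := intervalIntegral.integral_add_adjacent_intervals (hgi.mono_set hsub0)
      (hgi.mono_set hsub1)
    have heq : ε ^ (1 - κ) * qFun κ ε = κ * ∫ x in (0 : ℝ)..ε, g x := by
      rw [rpow_mul_qFun_eq κ hε hε1, hC', ← hadd]
      ring
    -- `|∫_0^ε g| ≤ B ε^{1-κ}/(1-κ)`
    have hbound : ‖∫ x in (0 : ℝ)..ε, g x‖ ≤ ∫ x in (0 : ℝ)..ε, B * x ^ (-κ) := by
      refine intervalIntegral.norm_integral_le_of_norm_le hε.le
        (Eventually.of_forall fun x hx => ?_)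
        ((intervalIntegral.intervalIntegrable_rpow' (by linarith : -1 < -κ)).const_mul B)
      have hx0 : 0 < x := hx.1
      have hxq : ‖qFun κ (x + 1)‖ ≤ B := hB x ⟨hx0.le, hx.2.trans hε1⟩
      rw [hg, norm_mul, Real.norm_of_nonneg (Real.rpow_nonneg hx0.le _), mul_comm]
      exact mul_le_mul_of_nonneg_right hxq (Real.rpow_nonneg hx0.le _)
    have hI : ∫ x in (0 : ℝ)..ε, B * x ^ (-κ) = B * (ε ^ (1 - κ) / (1 - κ)) := by
      rw [intervalIntegral.integral_const_mul, integral_rpow (Or.inl (by linarith))]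
      rw [show -κ + 1 = 1 - κ by ring, Real.zero_rpow h1κ.ne', sub_zero]
    rw [hI] at hbound
    have habs := (abs_le.mp (by simpa [Real.norm_eq_abs] using hbound)).1
    rw [heq]
    have : κ * -(B * (ε ^ (1 - κ) / (1 - κ))) = -(κ * B / (1 - κ)) * ε ^ (1 - κ) := by
      field_simp
    rw [← this]
    exact mul_le_mul_of_nonneg_left habs hκ0.le
  -- combine with the upper bound: `c ≤ (M + κB/(1-κ)) ε^{1-κ}` for all small `ε`, absurd
  set K : ℝ := M + κ * B / (1 - κ) with hK
  have hK : ∀ ε : ℝ, 0 < ε → ε ≤ 1 → c ≤ K * ε ^ (1 - κ) := by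
    intro ε hε hε1
    have h1 := hlow ε hε hε1
    have h2 := hM ε hε hε1
    rw [hK, add_mul]
    linarith
  have ht : Tendsto (fun ε : ℝ => K * ε ^ (1 - κ)) (𝓝[>] 0) (𝓝 0) := by
    have h0 : Tendsto (fun ε : ℝ => ε ^ (1 - κ)) (𝓝 (0 : ℝ)) (𝓝 0) := by
      have := (Real.continuousAt_rpow_const 0 (1 - κ) (Or.inr h1κ.le)).tendsto
      rwa [Real.zero_rpow h1κ.ne'] at this
    simpa using (h0.mono_left nhdsWithin_le_nhds).const_mul K
  obtain ⟨ε, hε1, hε2⟩ := ((ht.eventually_lt_const hc0).and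
    (Ioc_mem_nhdsGT (zero_lt_one' ℝ))).exists
  exact absurd (hK ε hε2.1 hε2.2) (not_le.mpr hε1)

end SieveAdjoint

/-! ### Normalised solutions with `β = 1` -/

/-- **Method of steps for the homogeneous scalar delay equation**: a function continuous on
`(0, ∞)` that vanishes on `(0, 1]` and satisfies `D'(t) = −k(t) D(t − 1)` for `t > 1`, `t ≠ 2`,
vanishes on `(0, ∞)` (on each `(n + 1, n + 2]` the derivative is `0`; the exceptional point
`t = 2` is never interior to the intervals `(1, t)`, `t ≤ 2`, or `(n + 1, t)`, `n ≥ 1`, used in the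
mean value theorem). [folklore] -/
theorem eq_zero_of_delay {D k : ℝ → ℝ} (hcont : ContinuousOn D (Ioi 0))
    (h0 : ∀ t ∈ Ioc (0 : ℝ) 1, D t = 0)
    (hderiv : ∀ t : ℝ, 1 < t → t ≠ 2 → HasDerivAt D (-(k t * D (t - 1))) t) {t : ℝ} (ht : 0 < t) :
    D t = 0 := by
  suffices H : ∀ n : ℕ, ∀ t ∈ Ioc (0 : ℝ) (n + 1), D t = 0 from
    H ⌈t⌉₊ t ⟨ht, by linarith [Nat.le_ceil t]⟩
  intro n
  induction n with
  | zero => intro t ht; exact h0 t (by simpa using ht)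
  | succ n ih =>
    intro t ht
    have hn0 : (0 : ℝ) ≤ n := n.cast_nonneg
    have ht2 : t ≤ (n : ℝ) + 1 + 1 := by have := ht.2; push_cast at this; linarith
    by_cases htn : t ≤ n + 1
    · exact ih t ⟨ht.1, htn⟩
    have htn : (n : ℝ) + 1 < t := not_le.mp htn
    have hc : ContinuousOn D (Icc ((n : ℝ) + 1) t) :=
      hcont.mono fun x hx => show (0 : ℝ) < x by linarith [hx.1]
    have hd : ∀ x ∈ Ioo ((n : ℝ) + 1) t, HasDerivAt D 0 x := by
      intro x hx
      have hx1 : 1 < x := by linarith [hx.1]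
      have hx2 : x ≠ 2 := by
        intro hx2e
        rcases Nat.eq_zero_or_pos n with hn | hn
        · subst hn
          have : t ≤ 2 := by norm_num at ht2; linarith
          linarith [hx.2]
        · have h1 : (1 : ℝ) ≤ n := by exact_mod_cast hn
          linarith [hx.1]
      have hD : D (x - 1) = 0 := ih (x - 1) ⟨by linarith, by linarith [hx.2]⟩
      simpa [hD] using hderiv x hx1 hx2
    rw [eq_of_hasDerivAt_zero_Ioo htn hc hd]
    exact ih _ ⟨by linarith, le_rfl⟩

/-- **The inner product of a rapidly decaying function tends to `0`**: if `Q = O(e^{−s})` and `q`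
has polynomial growth, then `⟨Q, q⟩_b(s) = s q(s) Q(s) − b ∫_{s−1}^{s} q(x+1) Q(x) dx → 0`
(Greaves (4.2.4.2): "because `Q(s) = o(s^{−2κ})` … `⟨Q, q⟩(s) → 0`"). [cite: Greaves2001, §4.2.4 (4.2)] -/
theorem tendsto_sieveInnerProduct_zero {b N : ℝ} {Q q : ℝ → ℝ}
    (hQ : Q =O[atTop] fun s : ℝ => Real.exp (-s)) (hqN₀ : q =O[atTop] fun s : ℝ => s ^ N) :
    Tendsto (sieveInnerProduct b Q q) atTop (𝓝 0) := by
  -- w.l.o.g. the exponent is nonnegative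
  set N' : ℝ := max N 0 with hNdef
  have hN0 : 0 ≤ N' := le_max_right _ _
  have hqN : q =O[atTop] fun s : ℝ => s ^ N' := by
    refine hqN₀.trans (IsBigO.of_bound 1 ?_)
    filter_upwards [eventually_ge_atTop (1 : ℝ)] with s hs
    rw [one_mul, Real.norm_of_nonneg (Real.rpow_nonneg (by linarith) _),
      Real.norm_of_nonneg (Real.rpow_nonneg (by linarith) _)]
    exact Real.rpow_le_rpow_of_exponent_le hs (le_max_left _ _)
  -- first term: `s q(s) Q(s) → 0`
  have hT1 : Tendsto (fun s : ℝ => s * q s * Q s) atTop (𝓝 0) := by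
    have h1 : (fun s : ℝ => s * q s) =O[atTop] fun s : ℝ => s ^ (N' + 1) := by
      refine ((isBigO_refl (fun s : ℝ => s) atTop).mul hqN).trans_eventuallyEq ?_
      filter_upwards [eventually_gt_atTop (0 : ℝ)] with s hs
      rw [Real.rpow_add_one hs.ne', mul_comm]
    refine (h1.mul hQ).trans_tendsto ?_
    simpa [neg_mul, one_mul] using tendsto_rpow_mul_exp_neg_mul_atTop_nhds_zero (N' + 1) 1 one_pos
  -- second term: the integral over `[s - 1, s]` tends to `0`
  have hT2 : Tendsto (fun s : ℝ => ∫ x in (s - 1)..s, q (x + 1) * Q x) atTop (𝓝 0) := by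
    obtain ⟨C₁, hC₁0, hC₁⟩ := hQ.exists_pos
    obtain ⟨C₂, hC₂0, hC₂⟩ := hqN.exists_pos
    obtain ⟨x₁, hx₁⟩ := eventually_atTop.mp hC₁.bound
    obtain ⟨x₂, hx₂⟩ := eventually_atTop.mp hC₂.bound
    set M : ℝ → ℝ := fun s => C₂ * (s + 1) ^ N' * (C₁ * Real.exp (-(s - 1))) with hM
    have hbound : ∀ᶠ s : ℝ in atTop,
        ‖∫ x in (s - 1)..s, q (x + 1) * Q x‖ ≤ M s * |s - (s - 1)| := by
      filter_upwards [eventually_ge_atTop (max (max x₁ x₂) 0 + 1)] with s hs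
      refine intervalIntegral.norm_integral_le_of_norm_le_const fun x hx => ?_
      rw [Set.uIoc_of_le (by linarith)] at hx
      have hxx₁ : x₁ ≤ x := by
        linarith [hx.1, le_max_left x₁ x₂, le_max_left (max x₁ x₂) 0]
      have hxx₂ : x₂ ≤ x + 1 := by
        linarith [hx.1, le_max_right x₁ x₂, le_max_left (max x₁ x₂) 0]
      have hx0 : 0 ≤ x := by linarith [hx.1, le_max_right (max x₁ x₂) 0]
      have hq' := hx₂ (x + 1) hxx₂
      have hQ' := hx₁ x hxx₁
      rw [Real.norm_of_nonneg (Real.rpow_nonneg (by linarith) _)] at hq'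
      rw [Real.norm_of_nonneg (Real.exp_pos _).le] at hQ'
      rw [norm_mul]
      have hC₂x : 0 ≤ C₂ * (x + 1) ^ N' := (norm_nonneg _).trans hq'
      calc ‖q (x + 1)‖ * ‖Q x‖
          ≤ C₂ * (x + 1) ^ N' * (C₁ * Real.exp (-x)) :=
            mul_le_mul hq' hQ' (norm_nonneg _) hC₂x
        _ ≤ C₂ * (s + 1) ^ N' * (C₁ * Real.exp (-(s - 1))) := by
            have hs1 : 0 ≤ (s + 1) ^ N' := Real.rpow_nonneg (by linarith [hx.1, hx.2]) _
            refine mul_le_mul ?_ ?_ (mul_nonneg hC₁0.le (Real.exp_pos _).le)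
              (mul_nonneg hC₂0.le hs1)
            · exact mul_le_mul_of_nonneg_left
                (Real.rpow_le_rpow (by linarith) (by linarith [hx.2]) hN0) hC₂0.le
            · exact mul_le_mul_of_nonneg_left (Real.exp_le_exp.mpr (by linarith [hx.1])) hC₁0.le
    have hM0 : Tendsto (fun s : ℝ => M s * |s - (s - 1)|) atTop (𝓝 0) := by
      have hsimp : (fun s : ℝ => M s * |s - (s - 1)|) =
          fun s => (C₂ * C₁ * Real.exp 2) * ((s + 1) ^ N' * Real.exp (-1 * (s + 1))) := by
        funext s
        simp only [hM, sub_sub_cancel, abs_one, mul_one]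
        have : Real.exp (-(s - 1)) = Real.exp 2 * Real.exp (-1 * (s + 1)) := by
          rw [← Real.exp_add]; ring_nf
        rw [this]; ring
      rw [hsimp]
      have hlim := (tendsto_rpow_mul_exp_neg_mul_atTop_nhds_zero N' 1 one_pos).comp
        (tendsto_atTop_add_const_right atTop (1 : ℝ) tendsto_id)
      simpa using hlim.const_mul (C₂ * C₁ * Real.exp 2)
    exact squeeze_zero_norm' hbound hM0
  have h := hT1.sub (hT2.const_mul b)
  simp only [mul_zero, sub_zero] at h
  exact h.congr' (Eventually.of_forall fun s => rfl)

namespace IsBetaSieveSolution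

variable {κ : ℝ} {F f : ℝ → ℝ} {β A : ℝ}

/-- **A solution with `β = 1` is the forward solution**: if `(F, f, 1, A)` solves the `β`-sieve
system of dimension `κ < 1` (normalisation not used), then `F − f = s^{−κ} · fwdQ κ 1 A` on
`(0, ∞)`, where `fwdQ` is the forward solution `s^κ Q` of `SieveFunctionsConstruction`
(uniqueness for the delay initial value problem by the method of steps, `eq_zero_of_delay`).
[folklore] -/
theorem sub_eq_fwdQ_of_beta_eq_one (h : IsBetaSieveSolution κ F f 1 A) (hκ1 : κ < 1) {t : ℝ}
    (ht : 0 < t) : F t - f t = t ^ (-κ) * fwdQ κ 1 A t := by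
  have hβ : (1 : ℝ) ≤ 1 := le_rfl
  have hκβ : (1 : ℝ) = 1 → κ < 1 := fun _ => hκ1
  set w : ℝ → ℝ := fwdQ κ 1 A with hw
  -- `D(t) = t^κ F(t) − t^κ f(t) − w(t)` vanishes identically on `(0, ∞)`
  set D : ℝ → ℝ := fun u => u ^ κ * F u - u ^ κ * f u - w u with hD
  have hDc : ContinuousOn D (Ioi 0) := by
    have hpow : ContinuousOn (fun u : ℝ => u ^ κ) (Ioi 0) :=
      continuousOn_id.rpow_const fun u hu => Or.inl (ne_of_gt hu)
    exact ((hpow.mul h.continuousOn_upper).sub (hpow.mul h.continuousOn_lower)).sub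
      (continuous_fwdQ hβ hκβ).continuousOn
  have hD0 : ∀ u ∈ Ioc (0 : ℝ) 1, D u = 0 := by
    intro u hu
    have hF := h.upper_eq u ⟨hu.1, by linarith [hu.2]⟩
    have hf := h.lower_eq u hu
    have hwu : w u = A := fwdQ_of_le hu.2
    simp only [hD, hF, hf, hwu, mul_zero, sub_zero]
    rw [← mul_assoc, mul_comm (u ^ κ) A, mul_assoc, ← Real.rpow_add hu.1, add_neg_cancel,
      Real.rpow_zero, mul_one, sub_self]
  have hDd : ∀ u : ℝ, 1 < u → u ≠ 2 → HasDerivAt D (-(sieveKernel κ u * D (u - 1))) u := by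
    intro u hu hu2
    have hu0 : 0 < u := by linarith
    -- `(u^κ F)' = κ u^{κ-1} f(u-1)` (for `1 < u < 2` both sides vanish)
    have hF : HasDerivAt (fun t : ℝ => t ^ κ * F t) (κ * u ^ (κ - 1) * f (u - 1)) u := by
      rcases lt_or_gt_of_ne hu2 with hu2 | hu2
      · have hf0 : f (u - 1) = 0 := h.lower_eq (u - 1) ⟨by linarith, by linarith⟩
        rw [hf0, mul_zero]
        refine (hasDerivAt_const u A).congr_of_eventuallyEq ?_
        filter_upwards [Ioo_mem_nhds hu0 hu2] with t ht
        rw [h.upper_eq t ⟨ht.1, by linarith [ht.2]⟩, ← mul_assoc, mul_comm (t ^ κ) A, mul_assoc,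
          ← Real.rpow_add ht.1, add_neg_cancel, Real.rpow_zero, mul_one]
      · exact h.hasDerivAt_upper u (by linarith)
    have hf : HasDerivAt (fun t : ℝ => t ^ κ * f t) (κ * u ^ (κ - 1) * F (u - 1)) u :=
      h.hasDerivAt_lower u hu
    have hwd : HasDerivAt w (-(sieveKernel κ u * w (u - 1))) u := hasDerivAt_fwdQ hβ hκβ hu
    refine ((hF.sub hf).sub hwd).congr_deriv ?_
    -- `k(u) (u-1)^κ = κ u^{κ-1}`
    have hk : sieveKernel κ u * (u - 1) ^ κ = κ * u ^ (κ - 1) := by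
      simp only [sieveKernel]
      rw [mul_assoc, ← Real.rpow_add (by linarith : (0 : ℝ) < u - 1), neg_add_cancel,
        Real.rpow_zero, mul_one]
    simp only [hD]
    have : κ * u ^ (κ - 1) * f (u - 1) - κ * u ^ (κ - 1) * F (u - 1) =
        -(sieveKernel κ u * ((u - 1) ^ κ * F (u - 1) - (u - 1) ^ κ * f (u - 1))) := by
      rw [← hk]; ring
    rw [this]; ring
  have hDt : D t = 0 := eq_zero_of_delay hDc hD0 hDd ht
  -- unfold `D t = 0`
  have hmul : t ^ (-κ) * t ^ κ = 1 := by
    rw [← Real.rpow_add ht, neg_add_cancel, Real.rpow_zero]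
  have : t ^ κ * (F t - f t) = w t := by
    have := hDt; simp only [hD] at this; linarith
  calc F t - f t = t ^ (-κ) * (t ^ κ * (F t - f t)) := by rw [← mul_assoc, hmul, one_mul]
    _ = t ^ (-κ) * w t := by rw [this]

/-- **A normalised solution with `β = 1` forces the `Q`-boundary constant to vanish**
(Greaves (4.2.4.2) and (4.2.4.7) with `B = 0`, `β = 1`): if `(F, f, 1, A)` is a NORMALISED
solution of dimension `0 ≤ κ < 1`, then `q_κ(1) − κ ∫_0^1 q_κ(x+1) x^{−κ} dx = 0`. Indeed
`⟨F − f, q_κ⟩_κ` is constant on `[1, ∞)` (inner-product engine of `SieveFunctionsProofs` applied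
to the forward combination `s^{−κ} fwdQ κ 1 A = F − f`), equal to `A` times that constant at
`s = 1`, and tends to `0` by the normalisation `F − f = O(e^{−s})`.
[cite: Greaves2001, §4.2.4 (4.2) and (4.7)] -/
theorem boundaryConst_eq_zero_of_beta_eq_one (h : IsBetaSieveSolution κ F f 1 A) (hκ0 : 0 ≤ κ)
    (hκ1 : κ < 1) : qFun κ 1 - κ * ∫ x in (0 : ℝ)..1, qFun κ (x + 1) * x ^ (-κ) = 0 := by
  have hβ : (1 : ℝ) ≤ 1 := le_rfl
  have hκβ : (1 : ℝ) = 1 → κ < 1 := fun _ => hκ1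
  set R : ℝ → ℝ := fun t => t ^ (-κ) * fwdQ κ 1 A t with hR
  set Ψ : ℝ → ℝ := sieveInnerProduct κ R (qFun κ) with hΨ
  -- constancy on `[1, ∞)` and the value at `1`
  have hconst : ∀ s : ℝ, 1 ≤ s → Ψ s = Ψ 1 := fun s hs =>
    innerProduct_fwd_eq hβ hκβ (b := κ) (c := -1) (by ring) (continuousOn_qFun κ)
      (fun s hs => hasDerivAt_mul_qFun κ hs) (continuous_fwdQ hβ hκβ)
      (fun s hs => by simpa only [neg_one_mul] using hasDerivAt_fwdQ hβ hκβ hs) hs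
  have hval : Ψ 1 = A * (qFun κ 1 - κ * ∫ x in (0 : ℝ)..1, qFun κ (x + 1) * x ^ (-κ)) := by
    have h1 := innerProduct_fwd_beta (κ := κ) (β := 1) (A := A) (b := κ) (r := qFun κ)
      (w := fwdQ κ 1 A) fun s hs => fwdQ_of_le hs
    rw [hΨ, hR, h1, sub_self, Real.one_rpow, one_mul, mul_one]
  -- `Ψ → 0`: on `(1, ∞)` the inner product is that of `F − f = O(e^{-s})`
  have hQ : (fun s : ℝ => F s - f s) =O[atTop] fun s : ℝ => Real.exp (-s) := by
    refine (h.upper_isBigO.sub h.lower_isBigO).congr_left fun s => ?_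
    ring
  obtain ⟨N, hqN⟩ := qFun_isBigO_rpow hκ0
  have hT0 := tendsto_sieveInnerProduct_zero (b := κ) hQ hqN
  have heq : ∀ᶠ s : ℝ in atTop, sieveInnerProduct κ (fun x => F x - f x) (qFun κ) s = Ψ s := by
    filter_upwards [eventually_gt_atTop (1 : ℝ)] with s hs
    simp only [hΨ, sieveInnerProduct, hR]
    rw [h.sub_eq_fwdQ_of_beta_eq_one hκ1 (by linarith : (0 : ℝ) < s)]
    congr 2
    refine intervalIntegral.integral_congr fun x hx => ?_
    rw [uIcc_of_le (by linarith)] at hx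
    show qFun κ (x + 1) * (F x - f x) = qFun κ (x + 1) * (x ^ (-κ) * fwdQ κ 1 A x)
    rw [h.sub_eq_fwdQ_of_beta_eq_one hκ1 (by linarith [hx.1] : (0 : ℝ) < x)]
  have hT : Tendsto Ψ atTop (𝓝 0) := hT0.congr' heq
  have hTc : Tendsto Ψ atTop (𝓝 (Ψ 1)) :=
    (tendsto_const_nhds (x := Ψ 1)).congr'
      (by filter_upwards [eventually_ge_atTop (1 : ℝ)] with s hs; exact (hconst s hs).symm)
  have h0 : Ψ 1 = 0 := tendsto_nhds_unique hTc hT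
  rw [hval] at h0
  rcases mul_eq_zero.mp h0 with hA | hC
  · exact absurd hA h.pos.ne'
  · exact hC

/-- **Every normalised solution of dimension `κ > 1/2` has `β > 1`** (Greaves (4.2.4.10): "`β > 1`
when `κ > 1/2`"; for `κ ≥ 1` this is `one_lt` of `SieveAdjoint`, for `1/2 < κ < 1` it is the
nonvanishing of the `β = 1` boundary constant, `SieveAdjoint.boundaryConst_one_ne_zero`).
[cite: Greaves2001, §4.2.4 (4.10)] -/
theorem one_lt_of_half_lt (h : IsBetaSieveSolution κ F f β A) (hκ : 1 / 2 < κ) : 1 < β := by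
  rcases le_or_gt 1 κ with h1 | h1
  · exact h.one_lt h1
  · by_contra hβ
    have hβ1 : β = 1 := le_antisymm (not_lt.mp hβ) h.one_le
    subst hβ1
    exact SieveAdjoint.boundaryConst_one_ne_zero hκ h1
      (h.boundaryConst_eq_zero_of_beta_eq_one (by linarith) h1)

/-- For `κ ≥ 1/2` a normalised solution has `β = 1` exactly when `κ = 1/2`
(`β_{1/2} = 1`, `IsBetaSieveSolution.beta_eq_one`; `β > 1` for `κ > 1/2`).
[cite: Greaves2001, §4.2.4 (4.10)] -/
theorem beta_eq_one_iff (h : IsBetaSieveSolution κ F f β A) (hκ : 1 / 2 ≤ κ) :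
    β = 1 ↔ κ = 1 / 2 := by
  constructor
  · intro hβ
    by_contra hne
    have := h.one_lt_of_half_lt (lt_of_le_of_ne hκ (Ne.symm hne))
    linarith
  · intro hκ'
    subst hκ'
    exact h.beta_eq_one

/-- **The sifting-limit equation without alternative**: for `κ > 1/2` every normalised solution
has `q_κ(β − 1) = 0` (compare `beta_eq_one_or_qFun_eq_zero`). [cite: Greaves2001, §4.2.4 (4.7), (4.10)] -/
theorem qFun_beta_sub_one_eq_zero' (h : IsBetaSieveSolution κ F f β A) (hκ : 1 / 2 < κ) :
    qFun κ (β - 1) = 0 :=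
  h.qFun_beta_sub_one_eq_zero (by linarith) (h.one_lt_of_half_lt hκ)

/-- **For `1/2 < κ < 1` all normalised solutions have the same parameter `β`** (`= 1 +` the
unique positive zero of `q_κ`, Greaves Lemma 4.2.3 and (4.2.4.10)). [cite: Greaves2001, §4.2.4 (4.10)] -/
theorem beta_eq_of_lt_one {F' f' : ℝ → ℝ} {β' A' : ℝ} (h : IsBetaSieveSolution κ F f β A)
    (h' : IsBetaSieveSolution κ F' f' β' A') (hκ : 1 / 2 < κ) (hκ1 : κ < 1) : β = β' := by
  have h1 := h.one_lt_of_half_lt hκ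
  have h1' := h'.one_lt_of_half_lt hκ
  have := SieveAdjoint.qFun_zero_unique hκ hκ1 (by linarith) (by linarith)
    (h.qFun_beta_sub_one_eq_zero' hκ) (h'.qFun_beta_sub_one_eq_zero' hκ)
  linarith

end IsBetaSieveSolution

/-! ### The two pins coincide for `1/2 ≤ κ ≤ 1` -/

/-- For `1/2 < κ < 1` the minimality clause of `IsBetaSieveData` is automatic. [folklore] -/
theorem isBetaSieveData_iff_of_lt_one {κ : ℝ} (hκ : 1 / 2 < κ) (hκ1 : κ < 1)
    (B : (ℝ → ℝ) × (ℝ → ℝ) × ℝ × ℝ) :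
    IsBetaSieveData κ B ↔ IsBetaSieveSolution κ B.1 B.2.1 B.2.2.1 B.2.2.2 :=
  ⟨fun h => h.1, fun h => ⟨h, fun _ _ _ _ h' => (h.beta_eq_of_lt_one h' hκ hκ1).le⟩⟩

/-- For `1/2 < κ < 1` the maximality clause of `IsGreatestBetaSieveData` is automatic. [folklore] -/
theorem isGreatestBetaSieveData_iff_of_lt_one {κ : ℝ} (hκ : 1 / 2 < κ) (hκ1 : κ < 1)
    (B : (ℝ → ℝ) × (ℝ → ℝ) × ℝ × ℝ) :
    IsGreatestBetaSieveData κ B ↔ IsBetaSieveSolution κ B.1 B.2.1 B.2.2.1 B.2.2.2 :=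
  ⟨fun h => h.1, fun h => ⟨h, fun _ _ _ _ h' => (h.beta_eq_of_lt_one h' hκ hκ1).ge⟩⟩

/-- **For `1/2 ≤ κ ≤ 1` the least-`β` and the greatest-`β` predicates coincide**:
`IsBetaSieveData κ = IsGreatestBetaSieveData κ` (the endpoints are `isBetaSieveData_half_eq`,
`isBetaSieveData_one_eq` of `SieveFunctionsBridge`). [folklore] -/
theorem isBetaSieveData_eq_isGreatestBetaSieveData {κ : ℝ} (hκ : 1 / 2 ≤ κ) (hκ1 : κ ≤ 1) :
    IsBetaSieveData κ = IsGreatestBetaSieveData κ := by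
  rcases eq_or_lt_of_le hκ with h | h
  · subst h; exact isBetaSieveData_half_eq
  rcases eq_or_lt_of_le hκ1 with h1 | h1
  · subst h1; exact isBetaSieveData_one_eq
  exact funext fun B => propext
    ((isBetaSieveData_iff_of_lt_one h h1 B).trans (isGreatestBetaSieveData_iff_of_lt_one h h1 B).symm)

/-- **The chosen data coincide for `1/2 ≤ κ ≤ 1`**: `betaSieveData κ = greatestBetaSieveData κ`
(both are `Classical.epsilon` of the same predicate; no existence fact is needed). [folklore] -/
theorem betaSieveData_eq_greatestBetaSieveData {κ : ℝ} (hκ : 1 / 2 ≤ κ) (hκ1 : κ ≤ 1) :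
    betaSieveData κ = greatestBetaSieveData κ := by
  unfold betaSieveData greatestBetaSieveData
  rw [isBetaSieveData_eq_isGreatestBetaSieveData hκ hκ1]

/-- `F_κ`: `upperSieveFun κ = iwaniecUpperSieveFun κ` for `1/2 ≤ κ ≤ 1`. [folklore] -/
theorem upperSieveFun_eq_iwaniecUpperSieveFun {κ : ℝ} (hκ : 1 / 2 ≤ κ) (hκ1 : κ ≤ 1) :
    upperSieveFun κ = iwaniecUpperSieveFun κ :=
  congrArg (fun B : (ℝ → ℝ) × (ℝ → ℝ) × ℝ × ℝ => B.1) (betaSieveData_eq_greatestBetaSieveData hκ hκ1)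

/-- `f_κ`: `lowerSieveFun κ = iwaniecLowerSieveFun κ` for `1/2 ≤ κ ≤ 1`. [folklore] -/
theorem lowerSieveFun_eq_iwaniecLowerSieveFun {κ : ℝ} (hκ : 1 / 2 ≤ κ) (hκ1 : κ ≤ 1) :
    lowerSieveFun κ = iwaniecLowerSieveFun κ :=
  congrArg (fun B : (ℝ → ℝ) × (ℝ → ℝ) × ℝ × ℝ => B.2.1)
    (betaSieveData_eq_greatestBetaSieveData hκ hκ1)

/-- `β_κ`: `siftingLimit κ = iwaniecSiftingLimit κ` for `1/2 ≤ κ ≤ 1`. [folklore] -/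
theorem siftingLimit_eq_iwaniecSiftingLimit {κ : ℝ} (hκ : 1 / 2 ≤ κ) (hκ1 : κ ≤ 1) :
    siftingLimit κ = iwaniecSiftingLimit κ :=
  congrArg (fun B : (ℝ → ℝ) × (ℝ → ℝ) × ℝ × ℝ => B.2.2.1)
    (betaSieveData_eq_greatestBetaSieveData hκ hκ1)

/-- `A_κ`: `betaSieveConst κ = iwaniecSieveConst κ` for `1/2 ≤ κ ≤ 1`. [folklore] -/
theorem betaSieveConst_eq_iwaniecSieveConst {κ : ℝ} (hκ : 1 / 2 ≤ κ) (hκ1 : κ ≤ 1) :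
    betaSieveConst κ = iwaniecSieveConst κ :=
  congrArg (fun B : (ℝ → ℝ) × (ℝ → ℝ) × ℝ × ℝ => B.2.2.2)
    (betaSieveData_eq_greatestBetaSieveData hκ hκ1)

/-- **`β_κ > 1` for `κ > 1/2`** (least-`β` pin), unconditionally (existence is
`exists_isBetaSieveData_holds`). [cite: Greaves2001, §4.2.4 (4.10)] -/
theorem one_lt_siftingLimit {κ : ℝ} (hκ : 1 / 2 < κ) : 1 < siftingLimit κ :=
  (isBetaSieveSolution_upperSieveFun_lowerSieveFun exists_isBetaSieveData_holds hκ.le).one_lt_of_half_lt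
    hκ

/-- **`β_κ > 1` for `κ > 1/2`** (Iwaniec's pin; Greaves (4.2.4.10)), unconditionally (existence is
`exists_isGreatestBetaSieveData_holds`). [cite: Greaves2001, §4.2.4 (4.10)] -/
theorem one_lt_iwaniecSiftingLimit {κ : ℝ} (hκ : 1 / 2 < κ) : 1 < iwaniecSiftingLimit κ :=
  (isBetaSieveSolution_iwaniecUpperSieveFun_iwaniecLowerSieveFun exists_isGreatestBetaSieveData_holds
    hκ.le).one_lt_of_half_lt hκ

/-- For `1/2 < κ < 1`, `β_κ − 1` is THE positive zero of `q_κ`: `q_κ(β_κ − 1) = 0` and every positive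
zero of `q_κ` equals `β_κ − 1` (Greaves, Lemma 4.2.3 and (4.2.4.10)). [cite: Greaves2001, §4.2.4 (4.10)] -/
theorem qFun_eq_zero_iff_of_lt_one {κ : ℝ} (hκ : 1 / 2 < κ) (hκ1 : κ < 1) {s : ℝ} (hs : 0 < s) :
    qFun κ s = 0 ↔ s = siftingLimit κ - 1 := by
  have hsol := isBetaSieveSolution_upperSieveFun_lowerSieveFun exists_isBetaSieveData_holds hκ.le
  have h0 := hsol.qFun_beta_sub_one_eq_zero' hκ
  constructor
  · intro h
    exact SieveAdjoint.qFun_zero_unique hκ hκ1 hs (by linarith [hsol.one_lt_of_half_lt hκ]) h h0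
  · rintro rfl; exact h0

/-! ### The `κ ≤ 1` fragments of `jurkat_richert_upper` / `jurkat_richert_lower` -/

namespace SieveSequence

/-- **The `β`-sieve upper bound in dimensions `1/2 ≤ κ ≤ 1`, in the notation of
`jurkat_richert_upper`** (Jurkat–Richert 1965 for `κ = 1`; Iwaniec, *Rosser's sieve*, Thm 1):
the restriction of the named fact `SieveSequence.jurkat_richert_upper` (least-`β` functions) to
`κ ≤ 1` follows from the corrected corollary `SieveSequence.Iwaniec1980_upper` of Iwaniec's
Theorem 1, because `upperSieveFun κ = iwaniecUpperSieveFun κ` there. (For `κ = 3/2` the two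
functions differ, `siftingLimit_three_halves_lt`; for `κ = 2` the least-`β` statement is false,
`SieveSequence.not_jurkat_richert_upper`.) [cite: IwaniecActaArith1980, Thm 1] -/
theorem jurkat_richert_upper_of_le_one (h : Iwaniec1980_upper) (A : SieveSequence) {κ L θ : ℝ}
    (hκ : 1 / 2 ≤ κ) (hκ1 : κ ≤ 1) (hθ : 0 < θ) (hdim : HasIwaniecDimension A.density κ L)
    (hlevel : HasLevelOfDistribution A θ) (hsize : ∀ᶠ x : ℝ in atTop, 0 ≤ A.size x) :
    ∀ ε δ : ℝ, 0 < ε → 0 < δ → ∀ᶠ x : ℝ in atTop, ∀ z : ℝ, 2 ≤ z → z ≤ x ^ (θ - δ) →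
      A.sifted x (primesProdBelow z) ≤
        A.size x * A.densityProduct (primesProdBelow z) *
          (upperSieveFun κ (θ * Real.log x / Real.log z) + ε) := by
  rw [upperSieveFun_eq_iwaniecUpperSieveFun hκ hκ1]
  exact h A hκ hθ hdim hlevel hsize

/-- **The `β`-sieve lower bound in dimensions `1/2 ≤ κ ≤ 1`, in the notation of
`jurkat_richert_lower`**: the restriction of `SieveSequence.jurkat_richert_lower` to `κ ≤ 1`
follows from `SieveSequence.Iwaniec1980_lower`, because `lowerSieveFun κ = iwaniecLowerSieveFun κ`
there. (For `κ = 2` the least-`β` statement is false, `SieveSequence.not_jurkat_richert_lower`.)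
[cite: IwaniecActaArith1980, Thm 1] -/
theorem jurkat_richert_lower_of_le_one (h : Iwaniec1980_lower) (A : SieveSequence) {κ L θ : ℝ}
    (hκ : 1 / 2 ≤ κ) (hκ1 : κ ≤ 1) (hθ : 0 < θ) (hdim : HasIwaniecDimension A.density κ L)
    (hlevel : HasLevelOfDistribution A θ) (hsize : ∀ᶠ x : ℝ in atTop, 0 ≤ A.size x) :
    ∀ ε δ : ℝ, 0 < ε → 0 < δ → ∀ᶠ x : ℝ in atTop, ∀ z : ℝ, 2 ≤ z → z ≤ x ^ (θ - δ) →
      A.size x * A.densityProduct (primesProdBelow z) *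
          (lowerSieveFun κ (θ * Real.log x / Real.log z) - ε) ≤
        A.sifted x (primesProdBelow z) := by
  rw [lowerSieveFun_eq_iwaniecLowerSieveFun hκ hκ1]
  exact h A hκ hθ hdim hlevel hsize

end SieveSequence

end Literature.NumberTheory.Sieve
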